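import Summits.BirchSwinnertonDyer.BirchSwinnertonDyer.Theorems.AlignedTransportAtTwoMainConjectureOfRankZeroBSDAtTwoFineRoadRealKummerLinesLetterSwitchStratum
import Literature.NumberTheory.EllipticCurves.ManinConstantQuadraticTwistAtTwoOrdinaryProofs
import Mathlib.NumberTheory.RamificationInertia.Basic
import HarnessLib

/-!
# ON the Kilford stratum EVERY prime of the cubic field above `2` is cut out by one of the three `ℚ₂`-roots — the plumbing
# that reads `AlignedAtTwo` back from the `ℚ₂`-clause (att-p4 g11: «a kernel proof needs completions of F at v ∣ 2 — not attempted»)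

Cell `bsd-f1-sign2`, WIDTH-5 attach seat `bsd-line-att-p5` (gen 16) on line `birth` of crux C2 stmt-BirchSwinnertonDyer-22298
`MainConjectureOfRankZeroBSDAtTwo`; a `--supports 22298 --as helper` file, bearing on crux C1 `MainConjectureTransportAlignedAtTwo`
(stmt-22296; residual (R2) = the Kilford stratum). Companion of this gen's `…RealKummerLinesPadicLetterOnPoints` (the forward reading of
`AlignedAtTwo` on points); this file supplies what the CONVERSE needs. HONEST FRAMING: THEOREMS ONLY — no definition, no named fact, no
`sorry`; C1/C2-NEUTRAL; BSD is NOT proved by any of this. KNOWN frame (Neukirch II §8: primes above `p` ↔ embeddings into `ℚ̄_p`); kernel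
value: the route's `AlignedAtTwo F e₁ e₂` quantifies over ALL primes `v ∣ 2` of `𝓞 F`, while the cell's `2`-adic lemmas (g13/g14) speak of
`ℚ₂`-roots; the bridge (`…AlignedTransportAtTwoBridge`) goes roots → primes, and this file shows that ON the stratum the three roots EXHAUST
the primes.

WHAT.
* §1 `heightOneSpectrum_ne_of_apply_ne` — two embeddings `σ, τ : F → ℚ_p` that differ at some `x` cut out DIFFERENT primes (a rational `a`
  `p`-adically close to `σx` and a rational scale make an element integral at one prime and not at the other; density of `ℚ` in `ℚ_p`).
* §2 `card_le_finrank_of_forall_natCast_mem` — at most `[F : ℚ]` primes of `𝓞 F` contain `p` (Mathlib's fundamental identity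
  `Σ_{P ∣ p} e_P f_P = [F : ℚ]`, `Ideal.sum_ramification_inertia`).
* §3 `exists_int_b_of_isOrdinaryAt_two` (integer `b`-invariants, `b₂` odd, odd integral `Δ` for a globally minimal good-ordinary curve) and
  **`exists_root_forall_algHom_iff_of_onKilfordStratumAtTwo`**: `V/ℚ` globally minimal, good ordinary at `2`, `E_V(ℚ)[2] = 0`, ON the
  Kilford stratum; `F` a cubic number field with a root `e₁` of `c_V`. THEN for every prime `w` of `𝓞 F` above `2` there is a `ℚ₂`-root `θ`
  of `ψ_V = 4x³ + b₂x² + 2b₄x + b₆` such that EVERY `σ : F →ₐ[ℚ] ℚ₂` with `σ e₁ = 4θ` satisfies `w.valuation a ≤ 1 ↔ ‖σ a‖₂ ≤ 1` for all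
  `a ∈ F` (the three roots `yᵢ` of `c_V` in `ℚ₂` — `…LetterSwitchStratum.exists_padic_roots`: `‖y₁‖ = 1`, `‖y₂‖, ‖y₃‖ ≤ 1/4`,
  `‖y₂ − y₃‖ = 1/16`, so pairwise distinct — give three embeddings, hence §1 three distinct primes, hence §2 all of them).

References: J. Neukirch, *Algebraic Number Theory* (1999) II §8 (8.1)–(8.3); J. H. Silverman, *AEC* 2nd ed. (2009) VII.1–2, VIII.8;
K. Matsuno, Int. J. Number Theory 4 (2008) Thm. 4.2 (p. 413).
-/

set_option autoImplicit false
-- the Theorems namespace of this sub repeats the summit name by design (D-0017 nested layout)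
set_option linter.dupNamespace false

noncomputable section

open scoped Classical

namespace Summit.BirchSwinnertonDyer.BirchSwinnertonDyer.Theorems.AlignedTransportAtTwoFineRoad.RealKummerLinesPadicLetterOnPointsPrimes

open Polynomial WeierstrassCurve NumberField IsDedekindDomain Field Literature.NumberTheory.EllipticCurves
  Literature.NumberTheory.EllipticCurves.Greenberg1999
  Summit.BirchSwinnertonDyer.Rank1Residual.F1Sign2
  Summit.BirchSwinnertonDyer.BirchSwinnertonDyer.Theorems.AlignedTransportAtTwoFineRoad
  Summit.BirchSwinnertonDyer.BirchSwinnertonDyer.Theorems.AlignedTransportAtTwoBridge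
  Summit.BirchSwinnertonDyer.BirchSwinnertonDyer.Theorems.AlignedTransportAtTwoFineRoad.RealKummerLinesLetterSwitchStratum

/-! ## §1 Distinct embeddings cut out distinct primes -/

section Separation

variable {F : Type*} [Field F] [NumberField F] {p : ℕ} [Fact p.Prime]

/-- **Two embeddings `σ, τ : F → ℚ_p` that differ somewhere cut out different primes** (with `𝓞_v = σ⁻¹ℤ_p`, `𝓞_w = τ⁻¹ℤ_p`): pick a rational
`a` with `‖σx − a‖ < ‖τx − σx‖/p` (density of `ℚ` in `ℚ_p`) and a rational `c` with `‖c‖ = ‖τx − a‖⁻¹`; then `u = (c/p)(x − a)` has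
`‖σu‖ < 1` but `‖τu‖ = p > 1`, so `u ∈ 𝓞_v ∖ 𝓞_w`. [cite: NeukirchANT1999, II §8 (8.1)–(8.3)] -/
theorem heightOneSpectrum_ne_of_apply_ne (σ τ : F →+* ℚ_[p]) {v w : HeightOneSpectrum (𝓞 F)}
    (hv : ∀ a : F, v.valuation F a ≤ 1 ↔ ‖σ a‖ ≤ 1) (hw : ∀ a : F, w.valuation F a ≤ 1 ↔ ‖τ a‖ ≤ 1)
    {x : F} (hx : σ x ≠ τ x) : v ≠ w := by
  intro hvw
  have hp1 : (1 : ℝ) < p := by exact_mod_cast (Fact.out : p.Prime).one_lt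
  have hp0 : (0 : ℝ) < p := lt_trans zero_lt_one hp1
  set y : ℚ_[p] := σ x with hy
  set z : ℚ_[p] := τ x with hz
  have hd : 0 < ‖z - y‖ := norm_pos_iff.mpr (sub_ne_zero.mpr (Ne.symm hx))
  -- a rational `a` close to `y`
  obtain ⟨a, ha⟩ := Padic.rat_dense p y (div_pos hd hp0)
  have ha' : ‖y - (a : ℚ_[p])‖ < ‖z - y‖ := lt_of_lt_of_le ha (div_le_self hd.le hp1.le)
  have hza : ‖z - (a : ℚ_[p])‖ = ‖z - y‖ := by
    have hsum : z - (a : ℚ_[p]) = (z - y) + (y - a) := by ring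
    rw [hsum, Padic.add_eq_max_of_ne (ne_of_gt ha'), max_eq_left ha'.le]
  have hza0 : z - (a : ℚ_[p]) ≠ 0 := fun h ↦ by rw [h, norm_zero] at hza; exact hd.ne' hza.symm
  -- a rational `c` with `‖c‖ = ‖z - a‖⁻¹`
  obtain ⟨c, hc⟩ := Padic.rat_dense p (z - (a : ℚ_[p]))⁻¹ (norm_pos_iff.mpr (inv_ne_zero hza0))
  have hc' : ‖(c : ℚ_[p])‖ = ‖z - y‖⁻¹ := by
    have hsum : (c : ℚ_[p]) = (z - (a : ℚ_[p]))⁻¹ + -((z - (a : ℚ_[p]))⁻¹ - c) := by ring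
    rw [hsum, Padic.add_eq_max_of_ne (by rw [norm_neg]; exact (ne_of_gt hc)), norm_neg, max_eq_left hc.le, norm_inv, hza]
  -- the separating element
  set u : F := ((c / p : ℚ) : F) * (x - (a : F)) with hu
  have hσu : σ u = ((c : ℚ_[p]) / p) * (y - a) := by
    rw [hu, map_mul, map_sub, map_ratCast, map_ratCast, hy]; push_cast; ring
  have hτu : τ u = ((c : ℚ_[p]) / p) * (z - a) := by
    rw [hu, map_mul, map_sub, map_ratCast, map_ratCast, hz]; push_cast; ring
  have hnσ : ‖σ u‖ ≤ 1 := by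
    rw [hσu, norm_mul, norm_div, hc', Padic.norm_p, div_inv_eq_mul]
    have h1 : ‖z - y‖⁻¹ * (p : ℝ) * ‖y - (a : ℚ_[p])‖ < ‖z - y‖⁻¹ * (p : ℝ) * (‖z - y‖ / p) := by
      gcongr
    have h2 : ‖z - y‖⁻¹ * (p : ℝ) * (‖z - y‖ / p) = 1 := by field_simp
    linarith
  have hnτ : ¬ ‖τ u‖ ≤ 1 := by
    rw [hτu, norm_mul, norm_div, hc', Padic.norm_p, div_inv_eq_mul, hza, not_le]
    have h2 : ‖z - y‖⁻¹ * (p : ℝ) * ‖z - y‖ = p := by field_simp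
    rw [h2]; exact hp1
  rw [hvw] at hv
  exact hnτ ((hw u).mp ((hv u).mpr hnσ))

end Separation

/-! ## §2 At most `[F : ℚ]` primes of `𝓞 F` lie above `p` -/

section Counting

variable {F : Type*} [Field F] [NumberField F] (p : ℕ) [Fact p.Prime]

omit [NumberField F] in
/-- A height-one prime of `𝓞 F` containing `p` lies over `(p) ⊂ ℤ`. [folklore] -/
theorem liesOver_span_of_natCast_mem (v : HeightOneSpectrum (𝓞 F)) (hpv : (p : 𝓞 F) ∈ v.asIdeal) :
    v.asIdeal.LiesOver (Ideal.span {(p : ℤ)}) := by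
  refine ⟨?_⟩
  have hle : Ideal.span {(p : ℤ)} ≤ v.asIdeal.under ℤ := by
    rw [Ideal.span_le, Set.singleton_subset_iff]
    change (algebraMap ℤ (𝓞 F)) (p : ℤ) ∈ v.asIdeal
    rwa [map_natCast]
  haveI : (v.asIdeal.under ℤ).IsPrime := Ideal.IsPrime.under ℤ v.asIdeal
  exact (Int.ideal_span_isMaximal_of_prime p).eq_of_le (Ideal.IsPrime.ne_top inferInstance) hle

/-- **At most `[F : ℚ]` primes above `p`**: a finite set of height-one primes of `𝓞 F` all containing `p` has at most `[F : ℚ]`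
elements — each prime `P ∣ p` contributes `e_P f_P ≥ 1` to the fundamental identity `Σ_{P ∣ p} e_P f_P = [F : ℚ]`
(Mathlib `Ideal.sum_ramification_inertia`). [cite: NeukirchANT1999, II §8 (8.2), I (8.2)] -/
theorem card_le_finrank_of_forall_natCast_mem (s : Finset (HeightOneSpectrum (𝓞 F)))
    (hs : ∀ v ∈ s, (p : 𝓞 F) ∈ v.asIdeal) : s.card ≤ Module.finrank ℚ F := by
  classical
  have hpb : Ideal.span {(p : ℤ)} ≠ ⊥ := by
    rw [Ne, Ideal.span_singleton_eq_bot]; exact_mod_cast (Fact.out : p.Prime).ne_zero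
  haveI : (Ideal.span {(p : ℤ)}).IsMaximal := Int.ideal_span_isMaximal_of_prime p
  set T := IsDedekindDomain.primesOverFinset (Ideal.span {(p : ℤ)}) (𝓞 F) with hT
  -- every term of the fundamental identity is `≥ 1`
  have hterm : ∀ P ∈ T, 1 ≤ Ideal.ramificationIdx' (Ideal.span {(p : ℤ)}) P * Ideal.inertiaDeg' (Ideal.span {(p : ℤ)}) P := by
    intro P hP
    haveI := Ideal.Factors.liesOver (Ideal.span {(p : ℤ)}) (S := 𝓞 F) ⟨P, hP⟩
    exact Nat.one_le_iff_ne_zero.mpr (mul_ne_zero (Ideal.Factors.ramificationIdx_ne_zero (Ideal.span {(p : ℤ)}) (S := 𝓞 F) ⟨P, hP⟩)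
      (Ideal.inertiaDeg'_pos (Ideal.span {(p : ℤ)}) P).ne')
  have hsum := Ideal.sum_ramification_inertia (R := ℤ) (𝓞 F) ℚ F (p := Ideal.span {(p : ℤ)}) hpb
  have hTcard : T.card ≤ Module.finrank ℚ F := by
    have h := Finset.card_nsmul_le_sum T _ 1 hterm
    rw [smul_eq_mul, mul_one] at h
    exact h.trans hsum.le
  -- `s ↪ T` through `v ↦ v.asIdeal`
  have hmem : ∀ v ∈ s, v.asIdeal ∈ T := fun v hv ↦ by
    rw [hT, IsDedekindDomain.mem_primesOverFinset_iff hpb]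
    exact ⟨v.isPrime, liesOver_span_of_natCast_mem p v (hs v hv)⟩
  have hinj : Function.Injective (fun v : HeightOneSpectrum (𝓞 F) ↦ v.asIdeal) := fun v w h ↦ HeightOneSpectrum.ext h
  calc s.card = (s.image (fun v : HeightOneSpectrum (𝓞 F) ↦ v.asIdeal)).card := (Finset.card_image_of_injective s hinj).symm
    _ ≤ T.card := Finset.card_le_card (fun P hP ↦ by
        obtain ⟨v, hv, rfl⟩ := Finset.mem_image.mp hP
        exact hmem v hv)
    _ ≤ Module.finrank ℚ F := hTcard

/-- **Four height-one primes above `p` in a cubic field cannot be pairwise distinct**: in a number field of degree `3`, given primes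
`v₁, v₂, v₃` above `p` that are pairwise distinct, every prime `w` above `p` is one of them. [cite: NeukirchANT1999, II §8 (8.2)] -/
theorem eq_or_eq_or_eq_of_finrank_eq_three (hF : Module.finrank ℚ F = 3) {v₁ v₂ v₃ w : HeightOneSpectrum (𝓞 F)}
    (h₁ : (p : 𝓞 F) ∈ v₁.asIdeal) (h₂ : (p : 𝓞 F) ∈ v₂.asIdeal) (h₃ : (p : 𝓞 F) ∈ v₃.asIdeal) (hw : (p : 𝓞 F) ∈ w.asIdeal)
    (h12 : v₁ ≠ v₂) (h13 : v₁ ≠ v₃) (h23 : v₂ ≠ v₃) : w = v₁ ∨ w = v₂ ∨ w = v₃ := by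
  classical
  by_contra hnot
  push Not at hnot
  obtain ⟨hw1, hw2, hw3⟩ := hnot
  have hcard : ({v₁, v₂, v₃, w} : Finset (HeightOneSpectrum (𝓞 F))).card = 4 := by
    rw [Finset.card_insert_of_notMem (by simp [h12, h13, Ne.symm hw1]), Finset.card_insert_of_notMem (by simp [h23, Ne.symm hw2]),
      Finset.card_insert_of_notMem (by simp [Ne.symm hw3]), Finset.card_singleton]
  have hle := card_le_finrank_of_forall_natCast_mem p ({v₁, v₂, v₃, w} : Finset (HeightOneSpectrum (𝓞 F))) (by
    intro v hv
    simp only [Finset.mem_insert, Finset.mem_singleton] at hv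
    rcases hv with rfl | rfl | rfl | rfl <;> assumption)
  rw [hcard, hF] at hle
  omega

end Counting

/-! ## §3 ON the Kilford stratum the three `ℚ₂`-roots exhaust the primes of the cubic field above `2` -/

section Stratum

variable (V : WeierstrassCurve ℚ) [V.IsGloballyMinimal] [V.IsElliptic]

/-- **Integer `b`-invariants of a globally minimal, good-ordinary curve**: `b₂, b₄, b₆ ∈ ℤ` with `b₂` odd (`a₁` is odd: Silverman V.4 /
the tree's `odd_a₁_of_hasGoodReductionAtPrime_two_of_odd_frobeniusTrace_two`) and `Δ` an odd integer. [cite: SilvermanAEC2009, V.4, VII.1, VIII.8] -/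
theorem exists_int_b_of_isOrdinaryAt_two (hV : IsOrdinaryAt V 2) :
    ∃ B₂ B₄ B₆ D : ℤ, (V.b₂ = ((B₂ : ℤ) : ℚ) ∧ V.b₄ = ((B₄ : ℤ) : ℚ) ∧ V.b₆ = ((B₆ : ℤ) : ℚ)) ∧ ¬ 2 ∣ B₂ ∧ V.Δ = D ∧ ¬ 2 ∣ D := by
  have hmap := map_integralModelInt V
  have ha₁ : Odd (integralModelInt V).a₁ :=
    odd_a₁_of_hasGoodReductionAtPrime_two_of_odd_frobeniusTrace_two V hV.1
      (Int.not_even_iff_odd.mp fun h ↦ hV.2 (even_iff_two_dvd.mp h))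
  refine ⟨(integralModelInt V).b₂, (integralModelInt V).b₄, (integralModelInt V).b₆, minimalDiscriminantInt V, ⟨?_, ?_, ?_⟩, ?_,
    (cast_minimalDiscriminantInt V).symm, fun h ↦ V.not_hasGoodReductionAtPrime_of_dvd_minimalDiscriminantInt 2 h hV.1⟩
  · conv_lhs => rw [← hmap]
    rw [map_b₂, eq_intCast]
  · conv_lhs => rw [← hmap]
    rw [map_b₄, eq_intCast]
  · conv_lhs => rw [← hmap]
    rw [map_b₆, eq_intCast]
  · have hpar : Odd ((integralModelInt V).a₁ ^ 2 + 4 * (integralModelInt V).a₂) := ha₁.pow.add_even ⟨2 * (integralModelInt V).a₂, by ring⟩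
    rw [WeierstrassCurve.b₂]
    exact fun h ↦ Int.not_even_iff_odd.mpr hpar (even_iff_two_dvd.mpr h)

/-- **ON THE KILFORD STRATUM THE THREE `ℚ₂`-ROOTS EXHAUST THE PRIMES OF `F` ABOVE `2`.** `V/ℚ` globally minimal, good ordinary at `2`,
`E_V(ℚ)[2] = 0`, ON the stratum (`c_V` splits over `ℚ₂`); `F` a cubic number field with a root `e₁` of `c_V = X³ + b₂X² + 8b₄X + 16b₆`. THEN
for every prime `w` of `𝓞 F` above `2` there is a `ℚ₂`-root `θ` of `ψ_V = 4x³ + b₂x² + 2b₄x + b₆` such that EVERY `σ : F →ₐ[ℚ] ℚ₂` with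
`σ e₁ = 4θ` satisfies `𝓞_w = σ⁻¹(ℤ₂)`, i.e. `w.valuation a ≤ 1 ↔ ‖σ a‖₂ ≤ 1` for all `a ∈ F`. (The roots `y₁, y₂, y₃` of `c_V` in `ℚ₂` are
pairwise distinct — `‖y₁‖ = 1`, `‖y₂‖, ‖y₃‖ ≤ 1/4`, `‖y₂ − y₃‖ = 1/16` — so the three power-basis embeddings `e₁ ↦ yᵢ` cut out three distinct
primes (§1), which are all the primes above `2` (§2); `σ` is determined by `σ e₁`.) [cite: NeukirchANT1999, II §8 (8.2)–(8.3)]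
[cite: SilvermanAEC2009, VII.2] -/
theorem exists_root_forall_algHom_iff_of_onKilfordStratumAtTwo (hV : IsOrdinaryAt V 2) (ht : ∀ x : ℚ, ¬ HasRationalTwoTorsionX V x)
    (hs : OnKilfordStratumAtTwo V) {F : Type} [Field F] [NumberField F] (hF : Module.finrank ℚ F = 3) {e₁ : F}
    (he₁ : aeval e₁ (twoDivisionUCubic V) = 0) (w : HeightOneSpectrum (𝓞 F)) (h2w : (2 : 𝓞 F) ∈ w.asIdeal) :
    ∃ θ : ℚ_[2], 4 * θ ^ 3 + (V.b₂ : ℚ_[2]) * θ ^ 2 + 2 * (V.b₄ : ℚ_[2]) * θ + (V.b₆ : ℚ_[2]) = 0 ∧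
      ∀ σ : F →ₐ[ℚ] ℚ_[2], σ e₁ = 4 * θ → ∀ a : F, w.valuation F a ≤ 1 ↔ ‖σ a‖ ≤ 1 := by
  obtain ⟨B₂, B₄, B₆, D, hb, hodd, hΔ, hD⟩ := exists_int_b_of_isOrdinaryAt_two V hV
  obtain ⟨hb2, hb4, hb6⟩ := hb
  obtain ⟨y₁, y₂, y₃, hprod, hy₁, hy₂, hy₃, hy₂₃⟩ := exists_padic_roots V ⟨hb2, hb4, hb6⟩ hodd hΔ hD hs
  -- the three roots are pairwise distinct
  have h12 : y₁ ≠ y₂ := fun h ↦ by rw [h] at hy₁; rw [hy₁] at hy₂; norm_num at hy₂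
  have h13 : y₁ ≠ y₃ := fun h ↦ by rw [h] at hy₁; rw [hy₁] at hy₃; norm_num at hy₃
  have h23 : y₂ ≠ y₃ := fun h ↦ by rw [h, sub_self, norm_zero] at hy₂₃; norm_num at hy₂₃
  -- the power basis on `e₁`
  have hmin : minpoly ℚ e₁ = twoDivisionUCubic V := minpoly_eq_twoDivisionUCubic V ht he₁
  obtain ⟨pb, hgen, -⟩ := exists_powerBasis_gen_eq (natDegree_twoDivisionUCubic V) hF hmin
  have hroot : ∀ y : ℚ_[2], (y - y₁) * (y - y₂) * (y - y₃) = 0 → aeval y (minpoly ℚ pb.gen) = 0 := by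
    intro y hy
    rw [hgen, hmin]
    simp only [twoDivisionUCubic, map_add, map_mul, map_pow, aeval_X, aeval_C, eq_ratCast, hb2, hb4, hb6]
    push_cast
    rw [← hprod y] at hy
    linear_combination hy
  have hr₁ : (y₁ - y₁) * (y₁ - y₂) * (y₁ - y₃) = 0 := by ring
  have hr₂ : (y₂ - y₁) * (y₂ - y₂) * (y₂ - y₃) = 0 := by ring
  have hr₃ : (y₃ - y₁) * (y₃ - y₂) * (y₃ - y₃) = 0 := by ring
  set σ₁ : F →ₐ[ℚ] ℚ_[2] := pb.lift y₁ (hroot y₁ hr₁) with hσ₁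
  set σ₂ : F →ₐ[ℚ] ℚ_[2] := pb.lift y₂ (hroot y₂ hr₂) with hσ₂
  set σ₃ : F →ₐ[ℚ] ℚ_[2] := pb.lift y₃ (hroot y₃ hr₃) with hσ₃
  have hσe : σ₁ e₁ = y₁ ∧ σ₂ e₁ = y₂ ∧ σ₃ e₁ = y₃ := by
    refine ⟨?_, ?_, ?_⟩ <;> rw [← hgen] <;> exact pb.lift_gen _ _
  -- their primes
  obtain ⟨v₁, hv₁2, hv₁⟩ := exists_heightOneSpectrum_of_ringHom_padic (σ₁ : F →+* ℚ_[2])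
  obtain ⟨v₂, hv₂2, hv₂⟩ := exists_heightOneSpectrum_of_ringHom_padic (σ₂ : F →+* ℚ_[2])
  obtain ⟨v₃, hv₃2, hv₃⟩ := exists_heightOneSpectrum_of_ringHom_padic (σ₃ : F →+* ℚ_[2])
  have hne12 : v₁ ≠ v₂ := heightOneSpectrum_ne_of_apply_ne (σ₁ : F →+* ℚ_[2]) (σ₂ : F →+* ℚ_[2]) hv₁ hv₂ (x := e₁)
    (by change σ₁ e₁ ≠ σ₂ e₁; rw [hσe.1, hσe.2.1]; exact h12)
  have hne13 : v₁ ≠ v₃ := heightOneSpectrum_ne_of_apply_ne (σ₁ : F →+* ℚ_[2]) (σ₃ : F →+* ℚ_[2]) hv₁ hv₃ (x := e₁)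
    (by change σ₁ e₁ ≠ σ₃ e₁; rw [hσe.1, hσe.2.2]; exact h13)
  have hne23 : v₂ ≠ v₃ := heightOneSpectrum_ne_of_apply_ne (σ₂ : F →+* ℚ_[2]) (σ₃ : F →+* ℚ_[2]) hv₂ hv₃ (x := e₁)
    (by change σ₂ e₁ ≠ σ₃ e₁; rw [hσe.2.1, hσe.2.2]; exact h23)
  -- `w` is one of them
  have hw := eq_or_eq_or_eq_of_finrank_eq_three 2 hF hv₁2 hv₂2 hv₃2 (by exact_mod_cast h2w) hne12 hne13 hne23
  -- `ψ_V(yᵢ/4) = 0`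
  have hψ : ∀ y : ℚ_[2], (y - y₁) * (y - y₂) * (y - y₃) = 0 →
      4 * (y / 4) ^ 3 + (V.b₂ : ℚ_[2]) * (y / 4) ^ 2 + 2 * (V.b₄ : ℚ_[2]) * (y / 4) + (V.b₆ : ℚ_[2]) = 0 := by
    intro y hy
    rw [← hprod y] at hy
    rw [hb2, hb4, hb6, Rat.cast_intCast, Rat.cast_intCast, Rat.cast_intCast]
    linear_combination hy / 16
  -- an embedding with `σ e₁ = yᵢ` IS `σᵢ`
  have huniq : ∀ (σ τ : F →ₐ[ℚ] ℚ_[2]), σ e₁ = τ e₁ → σ = τ := fun σ τ h ↦ pb.algHom_ext (by rw [hgen]; exact h)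
  rcases hw with rfl | rfl | rfl
  · refine ⟨y₁ / 4, hψ y₁ hr₁, fun σ hσ a ↦ ?_⟩
    rw [huniq σ σ₁ (by rw [hσ, hσe.1]; ring)]; exact hv₁ a
  · refine ⟨y₂ / 4, hψ y₂ hr₂, fun σ hσ a ↦ ?_⟩
    rw [huniq σ σ₂ (by rw [hσ, hσe.2.1]; ring)]; exact hv₂ a
  · refine ⟨y₃ / 4, hψ y₃ hr₃, fun σ hσ a ↦ ?_⟩
    rw [huniq σ σ₃ (by rw [hσ, hσe.2.2]; ring)]; exact hv₃ a

end Stratum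

end Summit.BirchSwinnertonDyer.BirchSwinnertonDyer.Theorems.AlignedTransportAtTwoFineRoad.RealKummerLinesPadicLetterOnPointsPrimes

end
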